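import Summits.ResolutionOfSingularities.ResolutionOfSingularities.Theorems.FrobeniusLadderFInjectiveMacaulayficationFilteredReesCarrier
import Mathlib.RingTheory.Localization.Away.Basic
import Mathlib.RingTheory.Ideal.Quotient.Operations
import Mathlib.Algebra.BigOperators.Group.Finset.Basic
import HarnessLib

/-!
# (F4b) THE TWIST `X_j ↦ X_j s^{w_j}` of `k[X, s][1/s]`: it carries `f` to `s^D · f^h`, so `k[X,s][1/s]/(f) ≅ k[X,s][1/s]/(f^h)`
# (crux `FInjectiveMacaulayfication`, line `graded-engine` §17 filtered engine G4♮ — CRUX-PLAN v5 §1.3 piece (F4), second half, part 1)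

Support file for crux stmt-ResolutionOfSingularities-15315 (`FrobeniusLadder.FInjectiveMacaulayfication`), chain w45a,
seat res-L1-w45a-stub-3 (owner of (F0)/(F4)/(F5)). [OURS · L1 W4.5a] — NOT a statement of the manuscript; AI-written, weaker than
expert review.

Carrier of `FilteredReesCarrier` ((F0)): `A = MvPolynomial (Option (Fin n)) k`, `s = X none`, `hfh : fh = Σ_b c_b X^b s^{w·b − D}`.
Write `Aₛ = Localization.Away (X none)` (`= k[X][s, s⁻¹]`). This file constructs the TWIST and its consequence:

* `aeval_mulPow_monomial` — twisted evaluation with an honest element `t`: `X^d ↦ φ(X^d) · t^{e·d}` under `X_o ↦ φ(X_o)·t^{e o}`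
  (`ℕ`-weights `e`; companion of (F0)'s Laurent version); `weight_elimZero_mapDomain` — the `(w, 0)`-weight of `X^b s^m` is `w·b`;
* `exists_awayTwist` — the substitution `X_o ↦ X_o · τ^{(w,0)_o}` extends to `Aₛ` for every `τ ∈ Aₛ` (`IsLocalization.Away.lift`);
* `exists_twist` — **a ring automorphism `Θ` of `Aₛ`** with `Θ(s) = s`, `Θ(X_j) = X_j s^{w_j}`, `Θ(C r) = C r`, and
  **`Θ(f) = s^D · f^h`** (`f` embedded by `rename some`; inverse = the substitution with `s⁻¹`; the identity monomial by
  monomial, `hD0` making `w·b − D` honest);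
* `exists_quotient_twist` — hence the ideal `(f)·Aₛ` is carried onto `(f^h)·Aₛ` (`s^D` is a unit), the bridge through which
  (F4b part 2) proves `ℛ = A/(f^h)` a DOMAIN and (F5) transports `hoff` to `T′♮` off `V(s)`.

All proofs are glue on Mathlib and (F0); no definitions, no named facts. [folklore]
-/

-- single-problem summit: the doubled namespace component is forced
set_option linter.dupNamespace false

noncomputable section

namespace Summit.ResolutionOfSingularities.ResolutionOfSingularities.Theorems.FInjectiveMacaulayfication.FilteredReesTwist

open Summit.ResolutionOfSingularities.ResolutionOfSingularities.Theorems.FInjectiveMacaulayfication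

variable {k : Type} [Field k] {n : ℕ}

/-! ## Twisted evaluation with an honest element -/

/-- **Twisted evaluation of a monomial by an element `t`**: under `X_o ↦ φ(X_o) · t^{e o}`, `r·X^d ↦ φ(r·X^d) · t^{Σ dₒ eₒ}`.
[folklore] -/
theorem aeval_mulPow_monomial {σ : Type} (e : σ → ℕ) (S : Type) [CommRing S] [Algebra k S]
    (φ : MvPolynomial σ k →ₐ[k] S) (t : S) (d : σ →₀ ℕ) (r : k) :
    MvPolynomial.aeval (fun o : σ => φ (MvPolynomial.X o) * t ^ (e o)) (MvPolynomial.monomial d r) =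
      φ (MvPolynomial.monomial d r) * t ^ (Finsupp.weight e d) := by
  classical
  have hC : φ (MvPolynomial.C r) = algebraMap k S r := by
    rw [← MvPolynomial.algebraMap_eq]
    exact φ.commutes r
  rw [MvPolynomial.aeval_monomial, MvPolynomial.monomial_eq, map_mul, Finsupp.prod, Finsupp.prod, map_prod,
    Finsupp.weight_apply, Finsupp.sum, hC]
  simp only [mul_pow, ← map_pow, Finset.prod_mul_distrib, ← pow_mul, Finset.prod_pow_eq_pow_sum, smul_eq_mul,
    mul_assoc, mul_comm (e _)]

/-- The `(w, 0)`-weight of the exponent of `X^b s^m` is `w·b`. [folklore] -/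
theorem weight_elimZero_mapDomain (w : Fin n → ℕ) (b : Fin n →₀ ℕ) (m : ℕ) :
    Finsupp.weight (fun o : Option (Fin n) => o.elim 0 w) (Finsupp.mapDomain some b + Finsupp.single none m) =
      Finsupp.weight w b := by
  classical
  rw [map_add, Finsupp.weight_apply, Finsupp.weight_apply, Finsupp.weight_apply,
    Finsupp.sum_mapDomain_index (h := fun i c => c • (Option.elim i 0 w)) (fun _ => zero_smul ℕ _)
      (fun _ _ _ => add_smul _ _ _),
    Finsupp.sum_single_index (h := fun i c => c • (Option.elim i 0 w)) (zero_smul ℕ _)]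
  simp only [Option.elim_some, Option.elim_none, smul_zero, add_zero]

/-! ## The twist -/

/-- The substitution `X_o ↦ X_o · τ^{(w,0)_o}` (`τ ∈ Aₛ` arbitrary) extends along `A → Aₛ = A[1/s]` (it sends `s ↦ s`, a unit).
[folklore] -/
theorem exists_awayTwist (w : Fin n → ℕ) (τ : Localization.Away (MvPolynomial.X none : MvPolynomial (Option (Fin n)) k)) :
    ∃ Θ : Localization.Away (MvPolynomial.X none : MvPolynomial (Option (Fin n)) k) →+* Localization.Away (MvPolynomial.X none : MvPolynomial (Option (Fin n)) k), ∀ a : MvPolynomial (Option (Fin n)) k, Θ (algebraMap (MvPolynomial (Option (Fin n)) k) (Localization.Away (MvPolynomial.X none : MvPolynomial (Option (Fin n)) k)) a) =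
      MvPolynomial.aeval (fun o : Option (Fin n) => algebraMap (MvPolynomial (Option (Fin n)) k) (Localization.Away (MvPolynomial.X none : MvPolynomial (Option (Fin n)) k)) (MvPolynomial.X o) * τ ^ (o.elim 0 w)) a := by
  have hunit : IsUnit ((MvPolynomial.aeval (R := k)
      (fun o : Option (Fin n) => algebraMap (MvPolynomial (Option (Fin n)) k) (Localization.Away (MvPolynomial.X none : MvPolynomial (Option (Fin n)) k)) (MvPolynomial.X o) * τ ^ (o.elim 0 w))).toRingHom
        (MvPolynomial.X none)) := by
    rw [AlgHom.toRingHom_eq_coe, RingHom.coe_coe, MvPolynomial.aeval_X, Option.elim_none, pow_zero, mul_one]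
    exact IsLocalization.Away.algebraMap_isUnit _
  exact ⟨IsLocalization.Away.lift _ hunit, fun a => IsLocalization.Away.lift_eq _ hunit a⟩

/-- **THE TWIST `Θ` OF `k[X,s][1/s]`**: a ring automorphism with `Θ(s) = s`, `Θ(X_j) = X_j · s^{w_j}`, `Θ(C r) = C r`, carrying
`f` (embedded by `rename some`) to `s^D · f^h`. [folklore] -/
theorem exists_twist (w : Fin n → ℕ) (D : ℕ) (f : MvPolynomial (Fin n) k) (fh : MvPolynomial (Option (Fin n)) k)
    (hfh : fh = ∑ b ∈ f.support, MvPolynomial.monomial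
      (Finsupp.mapDomain some b + Finsupp.single none (Finsupp.weight w b - D)) (MvPolynomial.coeff b f))
    (hD0 : ∀ m < D, MvPolynomial.weightedHomogeneousComponent w m f = 0) :
    ∃ Θ : Localization.Away (MvPolynomial.X none : MvPolynomial (Option (Fin n)) k) ≃+* Localization.Away (MvPolynomial.X none : MvPolynomial (Option (Fin n)) k),
      Θ (algebraMap (MvPolynomial (Option (Fin n)) k) (Localization.Away (MvPolynomial.X none : MvPolynomial (Option (Fin n)) k)) (MvPolynomial.X none)) = algebraMap (MvPolynomial (Option (Fin n)) k) (Localization.Away (MvPolynomial.X none : MvPolynomial (Option (Fin n)) k)) (MvPolynomial.X none) ∧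
      (∀ j : Fin n, Θ (algebraMap (MvPolynomial (Option (Fin n)) k) (Localization.Away (MvPolynomial.X none : MvPolynomial (Option (Fin n)) k)) (MvPolynomial.X (some j))) =
        algebraMap (MvPolynomial (Option (Fin n)) k) (Localization.Away (MvPolynomial.X none : MvPolynomial (Option (Fin n)) k)) (MvPolynomial.X (some j)) * algebraMap (MvPolynomial (Option (Fin n)) k) (Localization.Away (MvPolynomial.X none : MvPolynomial (Option (Fin n)) k)) (MvPolynomial.X none) ^ (w j)) ∧
      (∀ r : k, Θ (algebraMap (MvPolynomial (Option (Fin n)) k) (Localization.Away (MvPolynomial.X none : MvPolynomial (Option (Fin n)) k)) (MvPolynomial.C r)) = algebraMap (MvPolynomial (Option (Fin n)) k) (Localization.Away (MvPolynomial.X none : MvPolynomial (Option (Fin n)) k)) (MvPolynomial.C r)) ∧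
      Θ (algebraMap (MvPolynomial (Option (Fin n)) k) (Localization.Away (MvPolynomial.X none : MvPolynomial (Option (Fin n)) k)) (MvPolynomial.rename some f)) =
        algebraMap (MvPolynomial (Option (Fin n)) k) (Localization.Away (MvPolynomial.X none : MvPolynomial (Option (Fin n)) k)) (MvPolynomial.X none) ^ D * algebraMap (MvPolynomial (Option (Fin n)) k) (Localization.Away (MvPolynomial.X none : MvPolynomial (Option (Fin n)) k)) fh := by
  classical
  set t : Localization.Away (MvPolynomial.X none : MvPolynomial (Option (Fin n)) k) := algebraMap (MvPolynomial (Option (Fin n)) k) (Localization.Away (MvPolynomial.X none : MvPolynomial (Option (Fin n)) k)) (MvPolynomial.X none) with ht_def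
  have ht : IsUnit t := IsLocalization.Away.algebraMap_isUnit (MvPolynomial.X none : MvPolynomial (Option (Fin n)) k)
  set ti : Localization.Away (MvPolynomial.X none : MvPolynomial (Option (Fin n)) k) := IsLocalization.Away.invSelf (MvPolynomial.X none : MvPolynomial (Option (Fin n)) k) with hti_def
  have hti : t * ti = 1 := IsLocalization.Away.mul_invSelf (MvPolynomial.X none : MvPolynomial (Option (Fin n)) k)
  obtain ⟨Θ, hΘ⟩ := exists_awayTwist (k := k) w t
  obtain ⟨Θ', hΘ'⟩ := exists_awayTwist (k := k) w ti
  -- values on generators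
  have hC : ∀ (τ : Localization.Away (MvPolynomial.X none : MvPolynomial (Option (Fin n)) k)) (r : k), MvPolynomial.aeval (R := k)
      (fun o : Option (Fin n) => algebraMap (MvPolynomial (Option (Fin n)) k) (Localization.Away (MvPolynomial.X none : MvPolynomial (Option (Fin n)) k)) (MvPolynomial.X o) * τ ^ (o.elim 0 w)) (MvPolynomial.C r) =
      algebraMap (MvPolynomial (Option (Fin n)) k) (Localization.Away (MvPolynomial.X none : MvPolynomial (Option (Fin n)) k)) (MvPolynomial.C r) := fun τ r => by
    rw [← MvPolynomial.algebraMap_eq, AlgHom.commutes, IsScalarTower.algebraMap_apply k (MvPolynomial (Option (Fin n)) k) (Localization.Away (MvPolynomial.X none : MvPolynomial (Option (Fin n)) k))]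
  have hΘt : Θ t = t := by rw [ht_def, hΘ, MvPolynomial.aeval_X, Option.elim_none, pow_zero, mul_one]
  have hΘ't : Θ' t = t := by rw [ht_def, hΘ', MvPolynomial.aeval_X, Option.elim_none, pow_zero, mul_one]
  have hΘX : ∀ j, Θ (algebraMap (MvPolynomial (Option (Fin n)) k) (Localization.Away (MvPolynomial.X none : MvPolynomial (Option (Fin n)) k)) (MvPolynomial.X (some j))) =
      algebraMap (MvPolynomial (Option (Fin n)) k) (Localization.Away (MvPolynomial.X none : MvPolynomial (Option (Fin n)) k)) (MvPolynomial.X (some j)) * t ^ (w j) := fun j => by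
    rw [hΘ, MvPolynomial.aeval_X, Option.elim_some]
  have hΘ'X : ∀ j, Θ' (algebraMap (MvPolynomial (Option (Fin n)) k) (Localization.Away (MvPolynomial.X none : MvPolynomial (Option (Fin n)) k)) (MvPolynomial.X (some j))) =
      algebraMap (MvPolynomial (Option (Fin n)) k) (Localization.Away (MvPolynomial.X none : MvPolynomial (Option (Fin n)) k)) (MvPolynomial.X (some j)) * ti ^ (w j) := fun j => by
    rw [hΘ', MvPolynomial.aeval_X, Option.elim_some]
  have hΘC : ∀ r : k, Θ (algebraMap (MvPolynomial (Option (Fin n)) k) (Localization.Away (MvPolynomial.X none : MvPolynomial (Option (Fin n)) k)) (MvPolynomial.C r)) = algebraMap (MvPolynomial (Option (Fin n)) k) (Localization.Away (MvPolynomial.X none : MvPolynomial (Option (Fin n)) k)) (MvPolynomial.C r) :=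
    fun r => by rw [hΘ, hC]
  have hΘ'C : ∀ r : k, Θ' (algebraMap (MvPolynomial (Option (Fin n)) k) (Localization.Away (MvPolynomial.X none : MvPolynomial (Option (Fin n)) k)) (MvPolynomial.C r)) = algebraMap (MvPolynomial (Option (Fin n)) k) (Localization.Away (MvPolynomial.X none : MvPolynomial (Option (Fin n)) k)) (MvPolynomial.C r) :=
    fun r => by rw [hΘ', hC]
  have hΘti : Θ ti = ti := by
    have h1 : t * Θ ti = 1 := by rw [← hΘt, ← map_mul, hti, map_one]
    calc Θ ti = ti * (t * Θ ti) := by rw [← mul_assoc, mul_comm ti t, hti, one_mul]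
      _ = ti := by rw [h1, mul_one]
  have hΘ'ti : Θ' ti = ti := by
    have h1 : t * Θ' ti = 1 := by rw [← hΘ't, ← map_mul, hti, map_one]
    calc Θ' ti = ti * (t * Θ' ti) := by rw [← mul_assoc, mul_comm ti t, hti, one_mul]
      _ = ti := by rw [h1, mul_one]
  -- `Θ ∘ Θ' = id = Θ' ∘ Θ` (check on `C r`, `s`, `X_j`)
  have hext : ∀ (Φ Ψ : Localization.Away (MvPolynomial.X none : MvPolynomial (Option (Fin n)) k) →+* Localization.Away (MvPolynomial.X none : MvPolynomial (Option (Fin n)) k)),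
      (∀ r : k, Φ (algebraMap (MvPolynomial (Option (Fin n)) k) (Localization.Away (MvPolynomial.X none : MvPolynomial (Option (Fin n)) k)) (MvPolynomial.C r)) = algebraMap (MvPolynomial (Option (Fin n)) k) (Localization.Away (MvPolynomial.X none : MvPolynomial (Option (Fin n)) k)) (MvPolynomial.C r)) →
      (∀ r : k, Ψ (algebraMap (MvPolynomial (Option (Fin n)) k) (Localization.Away (MvPolynomial.X none : MvPolynomial (Option (Fin n)) k)) (MvPolynomial.C r)) = algebraMap (MvPolynomial (Option (Fin n)) k) (Localization.Away (MvPolynomial.X none : MvPolynomial (Option (Fin n)) k)) (MvPolynomial.C r)) →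
      Φ t = t → Ψ t = t →
      (∀ j, Φ (Ψ (algebraMap (MvPolynomial (Option (Fin n)) k) (Localization.Away (MvPolynomial.X none : MvPolynomial (Option (Fin n)) k)) (MvPolynomial.X (some j)))) = algebraMap (MvPolynomial (Option (Fin n)) k) (Localization.Away (MvPolynomial.X none : MvPolynomial (Option (Fin n)) k)) (MvPolynomial.X (some j))) →
      Φ.comp Ψ = RingHom.id (Localization.Away (MvPolynomial.X none : MvPolynomial (Option (Fin n)) k)) := by
    intro Φ Ψ hΦC hΨC hΦt hΨt hX
    refine IsLocalization.ringHom_ext (Submonoid.powers (MvPolynomial.X none : MvPolynomial (Option (Fin n)) k)) ?_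
    refine MvPolynomial.ringHom_ext (fun r => ?_) (fun o => ?_)
    · rw [RingHom.comp_apply, RingHom.comp_apply, hΨC, hΦC, RingHom.id_comp]
    · rw [RingHom.comp_apply, RingHom.comp_apply, RingHom.id_comp]
      cases o with
      | none => rw [← ht_def, hΨt, hΦt]
      | some j => exact hX j
  have h1 : Θ.comp Θ' = RingHom.id (Localization.Away (MvPolynomial.X none : MvPolynomial (Option (Fin n)) k)) := by
    refine hext Θ Θ' hΘC hΘ'C hΘt hΘ't fun j => ?_
    rw [hΘ'X, map_mul, map_pow, hΘX, hΘti, mul_assoc, ← mul_pow, hti, one_pow, mul_one]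
  have h2 : Θ'.comp Θ = RingHom.id (Localization.Away (MvPolynomial.X none : MvPolynomial (Option (Fin n)) k)) := by
    refine hext Θ' Θ hΘ'C hΘC hΘ't hΘt fun j => ?_
    rw [hΘX, map_mul, map_pow, hΘ'X, hΘ't, mul_assoc, ← mul_pow, mul_comm ti t, hti, one_pow, mul_one]
  -- the key identity `Θ f = t^D · fh`, monomial by monomial
  have hmon : ∀ b ∈ f.support, Θ (algebraMap (MvPolynomial (Option (Fin n)) k) (Localization.Away (MvPolynomial.X none : MvPolynomial (Option (Fin n)) k))
      (MvPolynomial.monomial (Finsupp.mapDomain some b) (MvPolynomial.coeff b f))) =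
      t ^ D * algebraMap (MvPolynomial (Option (Fin n)) k) (Localization.Away (MvPolynomial.X none : MvPolynomial (Option (Fin n)) k)) (MvPolynomial.monomial
        (Finsupp.mapDomain some b + Finsupp.single none (Finsupp.weight w b - D)) (MvPolynomial.coeff b f)) := by
    intro b hb
    have hDb := FilteredReesCarrier.le_weight_of_mem_support w D f hD0 hb
    have h := aeval_mulPow_monomial (fun o : Option (Fin n) => Option.elim o 0 w) (Localization.Away (MvPolynomial.X none : MvPolynomial (Option (Fin n)) k))
      (IsScalarTower.toAlgHom k (MvPolynomial (Option (Fin n)) k) (Localization.Away (MvPolynomial.X none : MvPolynomial (Option (Fin n)) k))) t (Finsupp.mapDomain some b) (MvPolynomial.coeff b f)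
    have hw : Finsupp.weight (fun o : Option (Fin n) => Option.elim o 0 w) (Finsupp.mapDomain some b) = Finsupp.weight w b := by
      have := weight_elimZero_mapDomain w b 0
      rwa [Finsupp.single_zero, add_zero] at this
    rw [IsScalarTower.coe_toAlgHom', hw] at h
    rw [hΘ, h, MvPolynomial.monomial_add_single, map_mul, map_pow, ← ht_def, mul_left_comm, ← pow_add,
      Nat.add_sub_cancel' hDb, mul_comm]
  have hΘf : Θ (algebraMap (MvPolynomial (Option (Fin n)) k) (Localization.Away (MvPolynomial.X none : MvPolynomial (Option (Fin n)) k)) (MvPolynomial.rename some f)) = t ^ D * algebraMap (MvPolynomial (Option (Fin n)) k) (Localization.Away (MvPolynomial.X none : MvPolynomial (Option (Fin n)) k)) fh := by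
    conv_lhs => rw [MvPolynomial.as_sum f]
    rw [map_sum, map_sum, map_sum, hfh, map_sum, Finset.mul_sum]
    refine Finset.sum_congr rfl fun b hb => ?_
    rw [MvPolynomial.rename_monomial, hmon b hb]
  refine ⟨RingEquiv.ofRingHom Θ Θ' h1 h2, hΘt, hΘX, hΘC, hΘf⟩

/-- **`(f)·Aₛ` is carried onto `(f^h)·Aₛ` by the twist** (`s^D` is a unit), so `Aₛ ⧸ (f) ≃+* Aₛ ⧸ (f^h)` by `Ideal.quotientEquiv`.
[folklore] -/
theorem exists_quotient_twist (w : Fin n → ℕ) (D : ℕ) (f : MvPolynomial (Fin n) k)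
    (fh : MvPolynomial (Option (Fin n)) k)
    (hfh : fh = ∑ b ∈ f.support, MvPolynomial.monomial
      (Finsupp.mapDomain some b + Finsupp.single none (Finsupp.weight w b - D)) (MvPolynomial.coeff b f))
    (hD0 : ∀ m < D, MvPolynomial.weightedHomogeneousComponent w m f = 0) :
    ∃ Θ : Localization.Away (MvPolynomial.X none : MvPolynomial (Option (Fin n)) k) ≃+* Localization.Away (MvPolynomial.X none : MvPolynomial (Option (Fin n)) k),
      Θ (algebraMap (MvPolynomial (Option (Fin n)) k) (Localization.Away (MvPolynomial.X none : MvPolynomial (Option (Fin n)) k)) (MvPolynomial.X none)) = algebraMap (MvPolynomial (Option (Fin n)) k) (Localization.Away (MvPolynomial.X none : MvPolynomial (Option (Fin n)) k)) (MvPolynomial.X none) ∧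
      (∀ j : Fin n, Θ (algebraMap (MvPolynomial (Option (Fin n)) k) (Localization.Away (MvPolynomial.X none : MvPolynomial (Option (Fin n)) k)) (MvPolynomial.X (some j))) =
        algebraMap (MvPolynomial (Option (Fin n)) k) (Localization.Away (MvPolynomial.X none : MvPolynomial (Option (Fin n)) k)) (MvPolynomial.X (some j)) * algebraMap (MvPolynomial (Option (Fin n)) k) (Localization.Away (MvPolynomial.X none : MvPolynomial (Option (Fin n)) k)) (MvPolynomial.X none) ^ (w j)) ∧
      (∀ r : k, Θ (algebraMap (MvPolynomial (Option (Fin n)) k) (Localization.Away (MvPolynomial.X none : MvPolynomial (Option (Fin n)) k)) (MvPolynomial.C r)) = algebraMap (MvPolynomial (Option (Fin n)) k) (Localization.Away (MvPolynomial.X none : MvPolynomial (Option (Fin n)) k)) (MvPolynomial.C r)) ∧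
      (Ideal.span {algebraMap (MvPolynomial (Option (Fin n)) k) (Localization.Away (MvPolynomial.X none : MvPolynomial (Option (Fin n)) k)) (MvPolynomial.rename some f)}).map Θ =
        Ideal.span {algebraMap (MvPolynomial (Option (Fin n)) k) (Localization.Away (MvPolynomial.X none : MvPolynomial (Option (Fin n)) k)) fh} := by
  obtain ⟨Θ, hs, hX, hC, hf⟩ := exists_twist w D f fh hfh hD0
  refine ⟨Θ, hs, hX, hC, ?_⟩
  rw [Ideal.map_span, Set.image_singleton, hf]
  exact Ideal.span_singleton_mul_left_unit
    ((IsLocalization.Away.algebraMap_isUnit (MvPolynomial.X none : MvPolynomial (Option (Fin n)) k)).pow D) _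

end Summit.ResolutionOfSingularities.ResolutionOfSingularities.Theorems.FInjectiveMacaulayfication.FilteredReesTwist

end
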